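import Summits.Ventures.Crystal3D.Theorems.StickyWulffConstantPolycrystalWulffBoundZoneChimera

/-!
# `PolycrystalWulffBound`, rung `rung_columnar` — step 1: the CHIMERA lower bound for COLUMNAR single-axis
# twin textures (lattice constant along vertical lines; vertical twin walls of arbitrary azimuths)
# (line `PolyDensity`, crux `stmt-Ventures-19482`)

Route `StickyWulffConstant` of the venture `Summits/Ventures/Crystal3D`, second prover lane (poly-p2,
gen 8).  Setting: grains `G_f` with frames pairwise satisfying the crux's clause `Ax m` (bodies `B₀` or
`R_m '' B₀`), and the COLUMN CONDITION: a line parallel to the axis `m` never meets two grains with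
different lattices — every twin wall is VERTICAL (contains `m`), of any azimuth, planar or not (radial fans
of incoherent Σ3 `{112}`/`{110}` walls, prismatic colonies, …).  Then for every measurable
`C ⊇ ⋃_f (G_f + r·W(A_f))`:  `|⋃ G_f|^{1/3} + r·32^{1/3} ≤ |C|^{1/3}` (`columnar_chimera_lower`).
Engine: the fibre chimera Brunn–Minkowski inequality (`Chimera.chimera3_fibre_brunnMinkowski`) in the
orthonormal coordinates `(⟪w,·⟫, ⟪m,·⟫, ⟪u,·⟫)` — height and abscissa HORIZONTAL, fibres VERTICAL: the
mirror `R_m` reverses each vertical fibre in place, so the fibres of `B₀` and `R_m B₀` over every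
horizontal point have the same length; no lattice symmetry beyond `B₀ = W(A f₀)` is used.
Supersedes the single-azimuth `vertical_chimera_lower` / `layer_chimera_lower` (`…VerticalLamellarChimera`,
`…VerticalTexture`) — kept as the section-engine proofs.
WHAT THIS IS NOT: the rung (`…RungColumnar`); basal or inclined walls; the crux is not claimed.
-/

noncomputable section

open scoped BigOperators InnerProductSpace ENNReal Pointwise
open MeasureTheory Set

namespace Summit.Ventures.Crystal3D.Theorems

open Summit.Ventures.Crystal3D.Cruxes.TextureLiminf.TexShadow (E3)
open Literature.MathematicalPhysics.StatisticalMechanics (fccStacking barlowStacking IsHaggSeq)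

/-! ### The columnar chimera lower bound -/

/-- **Chimera lower bound for columnar single-axis twin textures.**  Grains `G_f` (measurable) with
frames pairwise satisfying `Ax m`; `u, w` unit vectors with `u, w ⊥ m`, `w ⊥ u` (any horizontal frame);
COLUMN CONDITION: `x ∈ G_f`, `x + t·m ∈ G_g ⇒ A_f Λ₀ = A_g Λ₀`.  If a measurable `C` contains `x + r·y`
for all `x ∈ G_f`, `y ∈ W(A_f)` (`r > 0`) and `0 < |⋃ G_f| < ∞`, then
`|⋃ G_f|^{1/3} + r·32^{1/3} ≤ |C|^{1/3}`. -/
theorem columnar_chimera_lower (m u w : E3) (hu : ‖u‖ = 1) (hw : ‖w‖ = 1) (hum : ⟪u, m⟫_ℝ = 0)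
    (hwm : ⟪w, m⟫_ℝ = 0) (hwu : ⟪w, u⟫_ℝ = 0)
    {k : ℕ} (G : Fin k → Set E3) (hG : ∀ f, MeasurableSet (G f)) (A : Fin k → (E3 ≃ₗᵢ[ℝ] E3))
    (hAx : ∀ f g, ∃ (L : E3 ≃ₗᵢ[ℝ] E3) (s₁ s₂ : E3) (σ σ' : ℤ → ℤ), IsHaggSeq σ ∧ IsHaggSeq σ' ∧
      L (EuclideanSpace.single (2 : Fin 3) (1 : ℝ)) = m ∧
      A f '' fccStacking 1 (Real.sqrt (2 / 3)) ⊆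
        (fun q => L q + s₁) '' barlowStacking 1 (Real.sqrt (2 / 3)) σ ∧
      A g '' fccStacking 1 (Real.sqrt (2 / 3)) ⊆
        (fun q => L q + s₂) '' barlowStacking 1 (Real.sqrt (2 / 3)) σ')
    (hcol : ∀ f g, ∀ x ∈ G f, ∀ t : ℝ, x + t • m ∈ G g →
      A f '' fccStacking 1 (Real.sqrt (2 / 3)) = A g '' fccStacking 1 (Real.sqrt (2 / 3)))
    (h0 : volume (⋃ f, G f) ≠ 0) (htop : volume (⋃ f, G f) ≠ ⊤)
    {r : ℝ} (hr : 0 < r) {C : Set E3} (hC : MeasurableSet C)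
    (hsub : ∀ f, ∀ x ∈ G f,
      ∀ y ∈ {y : E3 | ∀ ν : E3, ⟪y, ν⟫_ℝ ≤ Real.sqrt 2 / 4 *
        ∑ᶠ w ∈ {w | w ∈ fccStacking 1 (Real.sqrt (2 / 3)) ∧ ‖w‖ = 1}, |⟪w, (A f).symm ν⟫_ℝ|},
      x + r • y ∈ C) :
    volume (⋃ f, G f) ^ ((3 : ℕ)⁻¹ : ℝ) + ENNReal.ofReal r * (ENNReal.ofReal 32) ^ ((3 : ℕ)⁻¹ : ℝ) ≤
      volume C ^ ((3 : ℕ)⁻¹ : ℝ) := by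
  classical
  set e₂ : E3 := EuclideanSpace.single (2 : Fin 3) (1 : ℝ) with he₂
  set E' : Set E3 := ⋃ f, G f with hE'
  obtain ⟨x₀, hx₀⟩ := nonempty_of_measure_ne_zero h0
  obtain ⟨f₀, -⟩ := mem_iUnion.1 hx₀
  set B₀ : Set E3 := {y : E3 | ∀ ν : E3, ⟪y, ν⟫_ℝ ≤ Real.sqrt 2 / 4 *
    ∑ᶠ w ∈ {w | w ∈ fccStacking 1 (Real.sqrt (2 / 3)) ∧ ‖w‖ = 1}, |⟪w, (A f₀).symm ν⟫_ℝ|} with hB₀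
  have he : ‖e₂‖ = 1 := by rw [he₂, PiLp.norm_single, norm_one]
  have hm : ‖m‖ = 1 := by
    obtain ⟨L, -, -, -, -, -, -, hLm, -, -⟩ := hAx f₀ f₀
    rw [← hLm, LinearIsometryEquiv.norm_map, he]
  set Rm : E3 ≃ₗᵢ[ℝ] E3 := (ℝ ∙ m)ᗮ.reflection with hRm
  have hRm_apply : ∀ x, Rm x = x - (2 * ⟪m, x⟫_ℝ) • m := reflection_orthogonal_unit_apply hm
  -- the orthonormal frame `(w, m, u)`: abscissa `w`, fibre `m`, height `u`
  set v : Fin 3 → E3 := ![w, m, u] with hv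
  have hmu : ⟪m, u⟫_ℝ = 0 := by rw [real_inner_comm]; exact hum
  have hmw : ⟪m, w⟫_ℝ = 0 := by rw [real_inner_comm]; exact hwm
  have huw : ⟪u, w⟫_ℝ = 0 := by rw [real_inner_comm]; exact hwu
  have hvon : Orthonormal ℝ v := by
    rw [orthonormal_iff_ite]
    intro i j
    fin_cases i <;> fin_cases j <;>
      simp [hv, hu, hw, hm, hum, hwm, hwu, hmu, hmw, huw]
  have hvsp : ⊤ ≤ Submodule.span ℝ (Set.range v) :=
    (hvon.linearIndependent.span_eq_top_of_card_eq_finrank' (by simp)).ge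
  set b : OrthonormalBasis (Fin 3) ℝ E3 := OrthonormalBasis.mk hvon hvsp with hb
  have hbv : ∀ i, b i = v i := fun i => by rw [hb, OrthonormalBasis.coe_mk]
  -- the transport `T x = (⟪w,x⟫, ⟪m,x⟫, ⟪u,x⟫)`
  set meq : E3 ≃ᵐ (Fin 3 → ℝ) := (MeasurableEquiv.toLp 2 (Fin 3 → ℝ)).symm with hmeq
  set T : E3 ≃ᵐ (Fin 3 → ℝ) := b.repr.toHomeomorph.toMeasurableEquiv.trans meq with hT
  have hTapply : ∀ x, T x = meq (b.repr x) := fun x => rfl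
  have hTi : ∀ x i, (T x) i = ⟪v i, x⟫_ℝ := by
    intro x i
    rw [hTapply]
    show (b.repr x) i = ⟪v i, x⟫_ℝ
    rw [OrthonormalBasis.repr_apply_apply, hbv]
  have hT0 : ∀ x, (T x) 0 = ⟪w, x⟫_ℝ := fun x => by rw [hTi]; rfl
  have hT1 : ∀ x, (T x) 1 = ⟪m, x⟫_ℝ := fun x => by rw [hTi]; rfl
  have hT2 : ∀ x, (T x) 2 = ⟪u, x⟫_ℝ := fun x => by rw [hTi]; rfl
  have hTeq : ∀ x, T x = ![⟪w, x⟫_ℝ, ⟪m, x⟫_ℝ, ⟪u, x⟫_ℝ] := by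
    intro x; ext i; fin_cases i
    · exact hT0 x
    · exact hT1 x
    · exact hT2 x
  have hTmp : MeasurePreserving T volume volume :=
    b.repr.measurePreserving.trans (EuclideanSpace.volume_preserving_symm_measurableEquiv_toLp (Fin 3))
  have hTvol : ∀ X : Set E3, MeasurableSet X → volume (T '' X) = volume X := fun X hX => by
    rw [MeasurableEquiv.image_eq_preimage_symm]
    exact hTmp.symm.measure_preimage hX.nullMeasurableSet
  have hTadd : ∀ x y : E3, T (x + y) = T x + T y := fun x y => by
    rw [hTapply, hTapply, hTapply, map_add]; rfl
  have hmemT : ∀ (X : Set E3) (z : Fin 3 → ℝ), z ∈ T '' X ↔ T.symm z ∈ X := by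
    intro X z
    rw [MeasurableEquiv.image_eq_preimage_symm, mem_preimage]
  -- the mirror in transported coordinates: `R_m` reverses the (vertical) fibre coordinate
  have hTRm : ∀ x, T (Rm x) = ![(T x) 0, -(T x) 1, (T x) 2] := by
    intro x
    rw [hTeq, hTeq, hRm_apply]
    simp only [inner_sub_right, real_inner_smul_right, hum, hwm, real_inner_self_eq_norm_sq, hm]
    ext i; fin_cases i <;> simp
    ring
  have hsymmRm : ∀ z, Rm (T.symm z) = T.symm ![z 0, -z 1, z 2] := by
    intro z
    apply T.injective
    rw [hTRm, T.apply_symm_apply, T.apply_symm_apply]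
  -- bodies: `B₀` or `Rm '' B₀`; symmetries of `B₀`
  have hbody : ∀ f, {y : E3 | ∀ ν : E3, ⟪y, ν⟫_ℝ ≤ Real.sqrt 2 / 4 *
      ∑ᶠ w ∈ {w | w ∈ fccStacking 1 (Real.sqrt (2 / 3)) ∧ ‖w‖ = 1}, |⟪w, (A f).symm ν⟫_ℝ|} = B₀ ∨
      {y : E3 | ∀ ν : E3, ⟪y, ν⟫_ℝ ≤ Real.sqrt 2 / 4 *
      ∑ᶠ w ∈ {w | w ∈ fccStacking 1 (Real.sqrt (2 / 3)) ∧ ‖w‖ = 1}, |⟪w, (A f).symm ν⟫_ℝ|} = Rm '' B₀ :=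
    fun f => cruxWulffBody_eq_or_eq_reflection_image (hAx f₀ f)
  have hB₀c : IsCompact B₀ := isCompact_cruxWulffBody _
  have hrB₀m : MeasurableSet (r • B₀) := (hB₀c.smul r).isClosed.measurableSet
  have hmem_rRm : ∀ x, x ∈ r • (Rm '' B₀) ↔ Rm x ∈ r • B₀ := by
    intro x
    constructor
    · intro hx
      obtain ⟨_, ⟨y, hy, rfl⟩, rfl⟩ := Set.mem_smul_set.1 hx
      rw [map_smul, Submodule.reflection_reflection]
      exact Set.smul_mem_smul_set hy
    · intro hx
      obtain ⟨y, hy, hyx⟩ := Set.mem_smul_set.1 hx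
      have : x = r • Rm y := by
        have := congrArg Rm hyx
        rw [Submodule.reflection_reflection, map_smul] at this
        exact this.symm
      rw [this]
      exact Set.smul_mem_smul_set ⟨y, hy, rfl⟩
  set W₀ : Set (Fin 3 → ℝ) := T '' (r • B₀) with hW₀
  -- the fibres of the transported twin body are reflected fibres of `W₀`
  have hfib : ∀ η y ζ : ℝ, (![η, y, ζ] : Fin 3 → ℝ) ∈ T '' (r • (Rm '' B₀)) ↔
      (![η, -y, ζ] : Fin 3 → ℝ) ∈ W₀ := by
    intro η y ζ
    rw [hmemT, hmemT, hmem_rRm, hsymmRm]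
    simp
  have hfibvol : ∀ ζ η : ℝ, volume {y : ℝ | (![η, y, ζ] : Fin 3 → ℝ) ∈ T '' (r • (Rm '' B₀))} =
      volume {y : ℝ | (![η, y, ζ] : Fin 3 → ℝ) ∈ W₀} := by
    intro ζ η
    have hset : {y : ℝ | (![η, y, ζ] : Fin 3 → ℝ) ∈ T '' (r • (Rm '' B₀))} =
        (-1 : ℝ) • {y : ℝ | (![η, y, ζ] : Fin 3 → ℝ) ∈ W₀} := by
      ext y
      rw [mem_setOf_eq, hfib, Set.mem_smul_set_iff_inv_smul_mem₀ (by norm_num : (-1 : ℝ) ≠ 0),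
        mem_setOf_eq]
      norm_num
    rw [hset, Chimera.volume_smul_real1]
    simp
  -- the summand family: the body of the grains on the line `{⟪m,·⟫ = t, ⟪u,·⟫ = x}`
  set Wt : ℝ → ℝ → Set (Fin 3 → ℝ) := fun t x =>
    if h : ∃ f, ∃ y ∈ G f, ⟪u, y⟫_ℝ = t ∧ ⟪w, y⟫_ℝ = x then
      T '' (r • {y : E3 | ∀ ν : E3, ⟪y, ν⟫_ℝ ≤ Real.sqrt 2 / 4 *
        ∑ᶠ w ∈ {w | w ∈ fccStacking 1 (Real.sqrt (2 / 3)) ∧ ‖w‖ = 1}, |⟪w, (A h.choose).symm ν⟫_ℝ|})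
    else W₀ with hWt
  have hbodym : ∀ f, MeasurableSet (r • {y : E3 | ∀ ν : E3, ⟪y, ν⟫_ℝ ≤ Real.sqrt 2 / 4 *
      ∑ᶠ w ∈ {w | w ∈ fccStacking 1 (Real.sqrt (2 / 3)) ∧ ‖w‖ = 1}, |⟪w, (A f).symm ν⟫_ℝ|}) :=
    fun f => ((isCompact_cruxWulffBody (A f)).smul r).isClosed.measurableSet
  have hW₀m : MeasurableSet W₀ := (MeasurableEquiv.measurableSet_image _).2 hrB₀m
  have hWtm : ∀ t x, MeasurableSet (Wt t x) := by
    intro t x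
    by_cases hex : ∃ f, ∃ y ∈ G f, ⟪u, y⟫_ℝ = t ∧ ⟪w, y⟫_ℝ = x
    · simp only [hWt, dif_pos hex]
      exact (MeasurableEquiv.measurableSet_image _).2 (hbodym _)
    · simp only [hWt, dif_neg hex]
      exact hW₀m
  have hWt_cases : ∀ t x, Wt t x = W₀ ∨ Wt t x = T '' (r • (Rm '' B₀)) := by
    intro t x
    by_cases hex : ∃ f, ∃ y ∈ G f, ⟪u, y⟫_ℝ = t ∧ ⟪w, y⟫_ℝ = x
    · simp only [hWt, dif_pos hex]
      rcases hbody hex.choose with h | h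
      · left; rw [h]
      · right; rw [h]
    · left; simp only [hWt, dif_neg hex]
  have hdom : ∀ t x ζ η, volume {y : ℝ | (![η, y, ζ] : Fin 3 → ℝ) ∈ W₀} ≤
      volume {y : ℝ | (![η, y, ζ] : Fin 3 → ℝ) ∈ Wt t x} := by
    intro t x ζ η
    rcases hWt_cases t x with h | h
    · rw [h]
    · rw [h, hfibvol]
  have hE'm : MeasurableSet E' := MeasurableSet.iUnion hG
  have hsub' : ∀ z ∈ T '' E', ∀ w' ∈ Wt (z 2) (z 0), z + w' ∈ T '' C := by
    rintro z ⟨a, ha, rfl⟩ w' hw'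
    obtain ⟨f, haf⟩ := mem_iUnion.1 ha
    have hex : ∃ f', ∃ y ∈ G f', ⟪u, y⟫_ℝ = (T a) 2 ∧ ⟪w, y⟫_ℝ = (T a) 0 :=
      ⟨f, a, haf, (hT2 a).symm, (hT0 a).symm⟩
    have hWt_eq : Wt ((T a) 2) ((T a) 0) = T '' (r • {y : E3 | ∀ ν : E3, ⟪y, ν⟫_ℝ ≤ Real.sqrt 2 / 4 *
        ∑ᶠ w ∈ {w | w ∈ fccStacking 1 (Real.sqrt (2 / 3)) ∧ ‖w‖ = 1},
          |⟪w, (A hex.choose).symm ν⟫_ℝ|}) := by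
      simp only [hWt, dif_pos hex]
    obtain ⟨y, hy, hyu, hyw⟩ := hex.choose_spec
    -- `y` lies on the vertical line through `a`
    have hya : y = a + ⟪m, y - a⟫_ℝ • m := by
      have hsum := b.sum_repr' (y - a)
      rw [Fin.sum_univ_three, hbv, hbv, hbv] at hsum
      have h0' : ⟪v 0, y - a⟫_ℝ = 0 := by
        show ⟪w, y - a⟫_ℝ = 0
        rw [inner_sub_right, hyw, hT0, sub_self]
      have h2' : ⟪v 2, y - a⟫_ℝ = 0 := by
        show ⟪u, y - a⟫_ℝ = 0
        rw [inner_sub_right, hyu, hT2, sub_self]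
      rw [h0', h2', zero_smul, zero_smul, zero_add, add_zero] at hsum
      have hv1 : v 1 = m := rfl
      rw [hv1] at hsum
      rw [hsum, add_sub_cancel]
    have hlat := hcol f hex.choose a haf (⟪m, y - a⟫_ℝ) (hya ▸ hy)
    rw [hWt_eq, ← wulffBody_eq_of_image_eq hlat] at hw'
    obtain ⟨v', hv', rfl⟩ := hw'
    obtain ⟨y', hy', rfl⟩ := Set.mem_smul_set.1 hv'
    refine ⟨a + r • y', hsub f a haf y' hy', ?_⟩
    rw [hTadd]
  have hvW₀ : volume W₀ = ENNReal.ofReal (r ^ 3) * ENNReal.ofReal 32 := by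
    rw [hW₀, hTvol _ hrB₀m, Measure.addHaar_smul, finrank_euclideanSpace, Fintype.card_fin, hB₀,
      volume_cruxWulffBody, abs_of_pos (pow_pos hr 3)]
  have hchim := Chimera.chimera3_fibre_brunnMinkowski (A := T '' E') (C := T '' C) (W₀ := W₀) Wt
    ((MeasurableEquiv.measurableSet_image _).2 hE'm) ((MeasurableEquiv.measurableSet_image _).2 hC)
    hW₀m hWtm hdom hsub'
    (by rw [hTvol _ hE'm]; exact h0) (by rw [hTvol _ hE'm]; exact htop)
    (by
      rw [hvW₀]
      exact mul_ne_zero (ENNReal.ofReal_pos.2 (by positivity)).ne' (ENNReal.ofReal_pos.2 (by norm_num)).ne')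
    (by
      rw [hvW₀]
      exact ENNReal.mul_ne_top ENNReal.ofReal_ne_top ENNReal.ofReal_ne_top)
  have hroot : (ENNReal.ofReal (r ^ 3) * ENNReal.ofReal 32) ^ ((3 : ℕ)⁻¹ : ℝ) =
      ENNReal.ofReal r * ENNReal.ofReal 32 ^ ((3 : ℕ)⁻¹ : ℝ) := by
    rw [ENNReal.mul_rpow_of_nonneg _ _ (by positivity), ENNReal.ofReal_rpow_of_nonneg (by positivity)
      (by positivity), Real.pow_rpow_inv_natCast hr.le (by norm_num)]
  rw [hTvol _ hE'm, hTvol _ hC, hvW₀, hroot] at hchim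
  exact hchim

end Summit.Ventures.Crystal3D.Theorems

end
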